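import Literature.MathematicalPhysics.QuantumFieldTheory.BalabanImbrieJaffe1984to88.BIJ88Ineq5144EndPolyDecay
import Literature.MathematicalPhysics.QuantumFieldTheory.BalabanImbrieJaffe1984to88.BIJ88Ineq5144EndChainCT
import Literature.MathematicalPhysics.QuantumFieldTheory.BalabanImbrieJaffe1984to88.BIJ88EndChainNFluct309

/-!
# `BalabanImbrieJaffe1984to88.BIJ88Ineq5144EndChainNDecay` — T. Bałaban, J. Imbrie, A. Jaffe, *Effective action and cluster properties of the
abelian Higgs model*, Commun. Math. Phys. **114** (1988) 257–315 [BalabanImbrieJaffe1988], Sect. 5.14 (5.14.4) p. 309–310 [PDF 53–54] with Sect.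
5.13 p. 305–307 [PDF 49–51] and [Balaban1982Higgs2] (2.28)–(2.29) p. 563: **(5.14.4), LOCATED, ON END-DECORATED CHAINS OF EVERY LENGTH —
SIZE-UNIFORM** — the three-cube chain instance `BIJ88Ineq5144EndChainDecay.ineq5144_locAct_endChain_of_decay` (owner r16 v2.293: *«proved on
the instance class with clauses»*) extended to chains `X″ = □_a – □_b – ⋯ – □_n` of ANY number `N ≥ 3` of cubes with clauses that DO NOT DEPEND
ON `N` (owner's flag on `BIJ88Ineq5144EndPolyDecay`, HOME/lit-balaban-p36/INBOX.md 2026-08-23T09:33Z: there the regime clause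
`2^{|X″|−1}·W·R·(|X″|Wc₁δR)²/m ≤ θ^{β′(|X″|−2)}` grows with `|X″|`, a bounded-size class).  THE CLASS: the §5.13 model (sites `α`, cubes `I`, block
map, precision `Δ ≻ 0`, `Δ ≥ m·1`, cube-local slot fields and terms, `|V_Y| ≤ K_Y ≤ K₁`, `≤ G` slots per cube), SOURCELESS (`ℱ = 0`), the polymer
`X″ ∋ a, b, n` (pairwise distinct): `□_a` decorated by interaction slots only, every other cube of `X″` slot-free, `□_b` THE ONLY CUBE OF `X″ ∖ {a}`
COUPLED TO `□_a` (so `□_n` is far).  THE LETTERS: (b) the pointwise decay of the restricted interpolated inverse `|((Δ_{1_{Λ′}})_s↾Λ)⁻¹(x,l)| ≤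
c₁δ^{d(x,l)}` uniform in `s ∈ [0,1]^I` supported in `X″` (`Λ` = the sites off `□_a`); W, R; clause (ii) `K_Y e^{2GK₁} ≤ θ^{1+β′}/2`; the V-half
of the vacuum clause; `0 ≤ t ≤ 1`; the CHAIN GEOMETRY CLAUSE `d(x,l) ≥ |X″| − 2` for `x ∈ □_n` or `x` a site of `X″` coupled to `□_n` and `l ∈ □_b`
coupled to `□_a` (collinear chain of `N` cubes of side `r` with nearest-neighbour `Δ`: first layer of `□_b` vs last layer of the `(N−1)`-st cube /
`□_n`, `≥ (N−2)r − 1 ≥ (N−2)(r−1)` apart — depth `N − 2` in units `ℓ = r − 1`); and the TWO SIZE-FREE REGIME CLAUSES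

  `4W³R³c₁²δ² ≤ m·θ^{β′}`  (the three-cube clause of v2.293)      and      `2δ² ≤ θ^{β′}`  (one more cube: its decay `δ²` beats the doubling
  of the corner sum and pays `θ^{β′}`),

which give `2^{N−1}·W·R·(Wc₁δ^{N−2}R)²/m ≤ θ^{β′(N−2)}` for EVERY `N ≥ 3` (`regime_chainN`).  CONCLUSION, for every region `X`, `t`, `γ`, `H`:

  `|locAct (□∘γ) g₃ (H, X″)| ≤ θ^{|H| + β′·|X″ ∖ □(γ(H))|}`      (`ineq5144_locAct_endChainN_of_decay`),

and the same with (b), `c₁`, `δ`, `ds` and the depth clause REPLACED by `Δ`-letters through Combes–Thomas (`BIJ88Ineq5144EndChainCT.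
restricted_inv_decay_pow`: range `1` in a site pseudo-distance `d`, `|Δ_{xy}| ≤ h`, `≤ z` neighbours, rate `μ` with `h z(e^μ − 1) ≤ m/2`, unit
`ℓ > 0`, face clause `(|X″| − 2)·ℓ ≤ d(x,l)`)      (`ineq5144_locAct_endChainN_of_combesThomas`).

θ-ACCOUNTING (engine: `|g₃| ≤ 2^{N−1}·2K₀·M`, `M = W·R·(Wc₁δ^{N−2}R)²/m`): (D) `H ≠ ∅` — labels in `□_a`, `|X″∖□(γ(H))| = N − 1`: `θ^{|H|}` and
`□_b`'s `θ^{β′}` ← clause (ii) (`K₀ = (θ^{1+β′}/2)^{|H|}`, located surplus `a(Y) = 1`); `θ^{β′(N−2)}` ← the decay: `δ^{2(N−2)}` = print's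
`e^{−cr(e_k)}` for each of the `N − 2` cubes `□_b, …, □_{N−1}` crossed on the way to `□_n`, twice.  (V) `H = ∅` — `|X″∖□(γ(H))| = N`: `θ^{2β′}` ←
the vacuum clause, `θ^{β′(N−2)}` ← the decay.  PRINT'S COUNT (p. 310: *"The others, localized in region X, have a factor of e^{−cr(e_k)|X|}."*;
p. 307: *"If the walk ω(α) wanders through more than a few cubes, we begin to pickup factors e^{−cr(e_k)}. These control the sum over walks and
partitions, and the factorials, as in [9]."*): matched — one decay factor per undecorated cube beyond `□_b`, the corner-sum combinatorics `2^{N−1}`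
absorbed by the same factors (`2δ² ≤ θ^{β′}`); `□_b`'s factor from (ii) resp. the vacuum clause = the lineage's DECLARED BOOKKEEPING DIVERGENCE
(unchanged from the chain file; REMOVED in the clause variant `BIJ88Ineq5144EndChainNWalkCount`, p36 g20).  DIVERGENCE OF METHOD as in
`BIJ88Ineq5144EndChainDecay` (one conditioned `s_n`-derivative).

(v1.1 DOC-ONLY, owner docfix D-owner-v2.308: the two print quotes above corrected to the page — p. 310 = p0054 L30–31 ends at «e^{−cr(e_k)|X|}.»,
p. 307 = p0051 L15–16 reads «These control … as in [9].»; declarations byte-identical to v1 p361987.)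

statement-level skeleton of published theorems with citation tags; proofs where landed; nothing here is a claim about the Yang–Mills mass gap

PDF held: `paper:balaban1988-cmp114-bij-abelian-higgs-effective-action` (journal page = PDF page + 256); p. 309 (p0053 L14–16) (5.14.4) as quoted in
`BIJ88Ineq5144EndChainDecay`; p. 310 (p0054) and p. 307 (p0051) as quoted above; p. 305 (p0049 L17–18) the decay letter's printed source.

WHAT IS PROVED (unit `lit-balaban-p36`, generation 20 of the Phase-2 proof seat p36; SKELETON rows C2.Eq5.14.3-5.14.4 (flip item, instance class
widened: end-decorated chains of every length, size-uniform clauses) / C2.Eq5.14.5 (C1 xref) of `HOME/lit-balaban-r16/ROWS-C2-part2.md`, owner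
r16; 0 definitions, 0 `Prop` facts, theorems only).
* `regime_chainN` (the two size-free clauses imply the `N`-cube regime inequality for every `N ≥ 3`),
  **`ineq5144_locAct_endChainN_of_decay`**, **`ineq5144_locAct_endChainN_of_combesThomas`**.
HONEST SCOPE: sourceless end-decorated CHAINS (the neighbour clause and the depth clause encode the chain; for a branched end-decorated polymer
the depth is the path length `a → n`, which pays only the cubes on the path — not claimed); χ-decorated cubes, middle decorations and sources
are NOT covered.  Imports `BIJ88Ineq5144EndPolyDecay`, `BIJ88Ineq5144EndChainCT` (p36 g19), `BIJ88EndChainNFluct309` (p36 g20); modifies nothing;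
the head of record of row C2.Eq5.14.5 (`BIJ88Eq5145HeadThreeCubeChi`, p348629) is untouched.  NOT summit progress; NOT continuum; NOT Clay.  Cell
`lit-balaban` Phase 2, seat p36 gen 20 (owner r16, referee ref-5).
-/

noncomputable section

open Finset MeasureTheory Matrix Function Filter
open Literature.MathematicalPhysics.QuantumFieldTheory.Balaban1983to89
open Literature.MathematicalPhysics.QuantumFieldTheory.BalabanImbrieJaffe1984to88
open B2Eq228Conditioning (In Out resIn resOut glue blkIn blkMix condShift)
open BIJ88Sect5Statements (CutoffProfile)
open BIJ88DirichletForms305 (interpForm interpForm_posDef quadForm_interpForm_ge)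
open BIJ88PolymerRep5134 (corner)
open BIJ88PolymerRep5134GaussWitness (corner_mem_cube)
open BIJ88Expansion5143Gauss (fD fD_local)
open BIJ88SlotMomentsGauss308 (uD)
open BIJ88SlotConnectedGraph310 (uD_local)
open BIJ88Eq5145CornerModel (slotB slotY)
open BIJ88Eq5145CornerUrsell (cubeIn)
open BIJ88W6PrimeVsupp (actIn)
open BIJ88Ineq5144Located (locAct locAct_of_loc locAct_of_not_loc)
open BIJ88SecondOrder5133 (num Dfun)
open BIJ88ActInFarCube309 (abs_actIn_le_of_condMean_fluct)
open BIJ88EndChainFluct309 (exists_quadForm_le)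
open BIJ88EndChainNFluct309 (fluct_le_chainN)
open BIJ88Ineq5144EndChainDecay (fD_eq_one_of_free measurable_fD_of_inr abs_fD_le_of_inr abs_fD_empty_sub_one_le)
open BIJ88Ineq5144EndPolyDecay (bookkeeping_nonempty_poly bookkeeping_empty_poly)
open BIJ88Ineq5144EndChainCT (restricted_inv_decay_pow)

namespace Literature.MathematicalPhysics.QuantumFieldTheory.BalabanImbrieJaffe1984to88.BIJ88Ineq5144EndChainNDecay

/-! ## §1 The size-free regime clauses -/

/-- **the two size-free clauses imply the `N`-cube regime inequality for every `N = k + 3 ≥ 3`**: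
`2^{N−1}·W·R·(Wc₁δ^{N−2}R)²/m = (4W³R³c₁²δ²/m)·(2δ²)^{N−3} ≤ θ^{β′}·θ^{β′(N−3)} = θ^{β′(N−2)}`. [cite: BalabanImbrieJaffe1988, (5.14.4) p.309–310] -/
theorem regime_chainN {W R c₁ δ m θ β' : ℝ} (hW : 0 ≤ W) (hR : 0 ≤ R) (hm : 0 < m) (hθ0 : 0 < θ)
    (hδθ : 4 * (W ^ 3 * R ^ 3 * c₁ ^ 2 * δ ^ 2) ≤ m * θ ^ β') (hstep : 2 * δ ^ 2 ≤ θ ^ β') (k : ℕ) :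
    (2 : ℝ) ^ (k + 2) * (W * R * ((W * (c₁ * δ ^ (k + 1) * R)) ^ 2 * m⁻¹)) ≤ θ ^ (β' * ((k : ℝ) + 1)) := by
  induction k with
  | zero =>
    have h0 : (2 : ℝ) ^ (0 + 2) * (W * R * ((W * (c₁ * δ ^ (0 + 1) * R)) ^ 2 * m⁻¹)) =
        4 * (W ^ 3 * R ^ 3 * c₁ ^ 2 * δ ^ 2) * m⁻¹ := by ring
    rw [h0, Nat.cast_zero, zero_add, mul_one, mul_inv_le_iff₀ hm]
    linarith
  | succ k ih =>
    have h1 : (2 : ℝ) ^ (k + 1 + 2) * (W * R * ((W * (c₁ * δ ^ (k + 1 + 1) * R)) ^ 2 * m⁻¹)) =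
        (2 * δ ^ 2) * ((2 : ℝ) ^ (k + 2) * (W * R * ((W * (c₁ * δ ^ (k + 1) * R)) ^ 2 * m⁻¹))) := by ring
    have h0 : 0 ≤ (2 : ℝ) ^ (k + 2) * (W * R * ((W * (c₁ * δ ^ (k + 1) * R)) ^ 2 * m⁻¹)) := by positivity
    rw [h1, Nat.cast_succ, show β' * ((k : ℝ) + 1 + 1) = β' + β' * ((k : ℝ) + 1) by ring, Real.rpow_add hθ0]
    exact mul_le_mul hstep ih h0 (Real.rpow_nonneg hθ0.le _)

/-! ## §2 (5.14.4), located, on end-decorated chains of every length -/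

section Main

variable {α I : Type} [Fintype α] [DecidableEq α] [Fintype I] [DecidableEq I] (blk : α → I) (Δ : Matrix α α ℝ) (ℱ : α → ℝ)
variable (adj : I → I → Prop) [DecidableRel adj]
variable (χ : CutoffProfile) {ι υ : Type} [DecidableEq ι] [DecidableEq υ]
variable (p ek : ℝ) (B : Finset ι) (Φ : ι → (α → ℝ) → ℝ) (c : ι → ℝ) (Ys : Finset υ) (V : υ → (α → ℝ) → ℝ)
variable (cube : ↥B ⊕ ↥Ys → I)

/-- **(5.14.4) LOCATED ON AN END-DECORATED CHAIN OF ANY LENGTH, SIZE-UNIFORM CLAUSES** — see the module docstring for the class, the letters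
and the accounting; `X″ ∋ a, b, n` pairwise distinct, `□_a` the decorated cube (interaction slots only), every other cube of `X″` slot-free, `□_b`
the only cube of `X″ ∖ {a}` coupled to `□_a`, the depth clause `ds ≥ |X″| − 2`, `Λ = {x | □x ≠ a}` the conditioning set, `Λ′` the corner of the
precision, and the two size-free regime clauses. [cite: BalabanImbrieJaffe1988, (5.14.4) p.309–310; p.307 (Sect. 5.13)] -/
theorem ineq5144_locAct_endChainN_of_decay [Fintype ι] [Fintype υ]
    (hΔ : Δ.PosDef) {m : ℝ} (hm : 0 < m) (hΔm : ∀ φ : α → ℝ, m * (φ ⬝ᵥ φ) ≤ φ ⬝ᵥ (Δ *ᵥ φ))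
    (hΦloc : ∀ b : B, ∀ φ ψ : α → ℝ, (∀ x, blk x = cube (Sum.inl b) → φ x = ψ x) → Φ b φ = Φ b ψ)
    (hVloc : ∀ Y : Ys, ∀ φ ψ : α → ℝ, (∀ x, blk x = cube (Sum.inr Y) → φ x = ψ x) → V Y φ = V Y ψ)
    (hV : ∀ Y ∈ Ys, Measurable (V Y)) {KY : υ → ℝ} (hK : ∀ Y ∈ Ys, ∀ φ, |V Y φ| ≤ KY Y)
    {K₁ : ℝ} (hK₁0 : 0 ≤ K₁) (hK₁ : ∀ Y ∈ Ys, KY Y ≤ K₁) {G : ℕ} (hG : ∀ i, (univ.filter fun τ : ↥B ⊕ ↥Ys => cube τ = i).card ≤ G)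
    {θ β' : ℝ} (hθ0 : 0 < θ) (hθ1 : θ ≤ 1) (hβ : 0 ≤ β')
    (hvac : Real.exp (2 * G * K₁) - 1 ≤ θ ^ (2 * β') / 2) (hKθ₂ : ∀ Y ∈ Ys, KY Y * Real.exp (2 * G * K₁) ≤ θ ^ (1 + β') / 2)
    -- the geometry letters W (sites per cube) and R (off-diagonal row sums of `Δ`)
    {W : ℕ} (hW : ∀ i, (univ.filter fun x : α => blk x = i).card ≤ W)
    {R : ℝ} (hR0 : 0 ≤ R) (hR : ∀ x, ∑ y ∈ univ.filter (fun y => blk y ≠ blk x), |Δ x y| ≤ R)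
    -- the class: the sourceless end-decorated chain `X″ = a – b – ⋯ – n`
    (hℱ : ℱ = 0) (X'' : Finset I) {a b n : I} (haX : a ∈ X'') (hbX : b ∈ X'') (hnX : n ∈ X'') (hab : a ≠ b) (han : a ≠ n) (hbn : b ≠ n)
    (haV : ∀ b' : ↥B, cube (Sum.inl b') ≠ a) (hfree : ∀ τ : ↥B ⊕ ↥Ys, cube τ ∈ X'' → cube τ = a)
    (hnbr : ∀ l k, blk l ∈ X'' → blk l ≠ a → blk k = a → Δ l k ≠ 0 → blk l = b)
    -- the decay letter (b), the chain's depth, the two size-free regime clauses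
    (ds : α → α → ℕ) {c₁ δ : ℝ} (hc₁ : 0 ≤ c₁) (hδ0 : 0 ≤ δ) (hδ1 : δ ≤ 1)
    (hgeo : ∀ x l, (blk x = n ∨ (blk x ∈ X'' ∧ ∃ y, blk y = n ∧ Δ y x ≠ 0)) → blk l = b → (∃ k, blk k = a ∧ Δ l k ≠ 0) →
      X''.card - 2 ≤ ds x l)
    (Λc X : Finset I)
    (hdec : ∀ s : I → ℝ, (∀ l, 0 ≤ s l ∧ s l ≤ 1) → (∀ l, l ∉ X'' → s l = 0) →
      ∀ x l : In (fun x => blk x ≠ a),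
        |(blkIn (fun x => blk x ≠ a) (interpForm blk (interpForm blk Δ (corner ℝ Λc)) s))⁻¹ x l| ≤ c₁ * δ ^ ds x.1 l.1)
    (hδθ : 4 * ((W : ℝ) ^ 3 * R ^ 3 * c₁ ^ 2 * δ ^ 2) ≤ m * θ ^ β') (hstep : 2 * δ ^ 2 ≤ θ ^ β')
    {t : ℝ} (ht0 : 0 ≤ t) (ht1 : t ≤ 1) {L : Type} [DecidableEq L] (γ : L → ↥(slotB B Ys cube X) ⊕ ↥(slotY B Ys cube X)) (H : Finset L) :
    |locAct (cubeIn cube X ∘ γ) (actIn blk Δ ℱ adj χ p ek B Φ c Ys V cube Λc X t γ) H X''| ≤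
      θ ^ ((H.card : ℝ) + β' * ((X'' \ H.image (cubeIn cube X ∘ γ)).card : ℝ)) := by
  subst hℱ
  by_cases hloc : ∀ j ∈ H, (cubeIn cube X ∘ γ) j ∈ X''
  swap
  · rw [locAct_of_not_loc hloc, abs_zero]
    exact Real.rpow_nonneg hθ0.le _
  rw [locAct_of_loc hloc]
  -- the chain has at least the three cubes `a, b, n`
  have h3 : 3 ≤ X''.card := by
    have hsub : ({a, b, n} : Finset I) ⊆ X'' := by
      intro i hi
      simp only [mem_insert, mem_singleton] at hi
      rcases hi with rfl | rfl | rfl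
      exacts [haX, hbX, hnX]
    have hc : ({a, b, n} : Finset I).card = 3 := by
      rw [card_insert_of_notMem (by simp only [mem_insert, mem_singleton, not_or]; exact ⟨hab, han⟩), card_pair hbn]
    exact hc ▸ card_le_card hsub
  have h2 : 2 ≤ X''.card := by omega
  -- `□_n` is far: a site of `□_n` coupled to `□_a` would lie in `□_b`
  have hfar : ∀ x y, blk x = n → blk y = a → Δ x y = 0 := fun x y hx hy => by
    by_contra h
    exact hbn ((hnbr x y (hx ▸ hnX) (fun h' => han (h'.symm.trans hx)) hy h).symm.trans hx)
  -- every slot located in the polymer sits at `□_a`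
  have hslot : ∀ τ : ↥(slotB B Ys cube X) ⊕ ↥(slotY B Ys cube X), cubeIn cube X τ ∈ X'' → cubeIn cube X τ = a := by
    intro τ hτ
    rcases τ with b' | Y
    · exact hfree _ hτ
    · exact hfree _ hτ
  have hHa : ∀ j ∈ H, cubeIn cube X (γ j) = a := fun j hj => hslot _ (hloc j hj)
  have hfreei : ∀ i ∈ X'', i ≠ a → ∀ τ : ↥B ⊕ ↥Ys, cube τ ≠ i := fun i hi hia τ hτ =>
    hia ((hfree τ (hτ ▸ hi)).symm.trans hτ).symm
  -- the observable of the polymer is the decorated cube's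
  have hprod : ∀ ψ : α → ℝ, ∏ i ∈ X'',
      fD (uD χ p ek (slotB B Ys cube X) (fun b : ↥B => Φ b) (fun b : ↥B => c b) (slotY B Ys cube X) (fun Y : ↥Ys => V Y) t)
        (cubeIn cube X) γ H i ψ =
      fD (uD χ p ek (slotB B Ys cube X) (fun b : ↥B => Φ b) (fun b : ↥B => c b) (slotY B Ys cube X) (fun Y : ↥Ys => V Y) t)
        (cubeIn cube X) γ H a ψ := fun ψ =>
    prod_eq_single_of_mem a haX fun i hi hia => fD_eq_one_of_free χ p ek B Φ c Ys V cube X t γ (hfreei i hi hia) H ψ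
  -- the engine's hypotheses
  have hcs := corner_mem_cube (I := I) Λc
  have hΔc : (interpForm blk Δ (corner ℝ Λc)).PosDef := interpForm_posDef blk hΔ hcs
  have hmΔc : ∀ φ : α → ℝ, m * (φ ⬝ᵥ φ) ≤ φ ⬝ᵥ (interpForm blk Δ (corner ℝ Λc) *ᵥ φ) := quadForm_interpForm_ge blk hΔm hcs
  obtain ⟨Cu, hCu⟩ := exists_quadForm_le (interpForm blk Δ (corner ℝ Λc))
  have hf : ∀ i (φ ψ : α → ℝ), (∀ x, blk x = i → φ x = ψ x) →
      fD (uD χ p ek (slotB B Ys cube X) (fun b : ↥B => Φ b) (fun b : ↥B => c b) (slotY B Ys cube X) (fun Y : ↥Ys => V Y) t)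
        (cubeIn cube X) γ H i φ =
      fD (uD χ p ek (slotB B Ys cube X) (fun b : ↥B => Φ b) (fun b : ↥B => c b) (slotY B Ys cube X) (fun Y : ↥Ys => V Y) t)
        (cubeIn cube X) γ H i ψ := fun i φ ψ h =>
    fD_local blk γ (uD_local blk χ (cubeIn cube X) (fun b' φ ψ h => hΦloc b'.1 φ ψ h) (fun Y φ ψ h => hVloc Y.1 φ ψ h) t) H i φ ψ h
  have hfm : Measurable fun ψ : α → ℝ => ∏ i ∈ X'',
      fD (uD χ p ek (slotB B Ys cube X) (fun b : ↥B => Φ b) (fun b : ↥B => c b) (slotY B Ys cube X) (fun Y : ↥Ys => V Y) t)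
        (cubeIn cube X) γ H i ψ := by
    rw [show (fun ψ : α → ℝ => ∏ i ∈ X'',
        fD (uD χ p ek (slotB B Ys cube X) (fun b : ↥B => Φ b) (fun b : ↥B => c b) (slotY B Ys cube X) (fun Y : ↥Ys => V Y) t)
          (cubeIn cube X) γ H i ψ) = fun ψ =>
        fD (uD χ p ek (slotB B Ys cube X) (fun b : ↥B => Φ b) (fun b : ↥B => c b) (slotY B Ys cube X) (fun Y : ↥Ys => V Y) t)
          (cubeIn cube X) γ H a ψ from funext hprod]
    exact measurable_fD_of_inr χ p ek B Φ c Ys V cube X t γ haV hV H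
  have hlocP : ∀ φ ψ : α → ℝ, (∀ x, ¬ (fun x => blk x ≠ a) x → φ x = ψ x) →
      (∏ i ∈ X'',
        fD (uD χ p ek (slotB B Ys cube X) (fun b : ↥B => Φ b) (fun b : ↥B => c b) (slotY B Ys cube X) (fun Y : ↥Ys => V Y) t)
          (cubeIn cube X) γ H i φ) =
      ∏ i ∈ X'',
        fD (uD χ p ek (slotB B Ys cube X) (fun b : ↥B => Φ b) (fun b : ↥B => c b) (slotY B Ys cube X) (fun Y : ↥Ys => V Y) t)
          (cubeIn cube X) γ H i ψ := fun φ ψ h => by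
    rw [hprod, hprod]
    exact hf a φ ψ fun x hx => h x (not_ne_iff.2 hx)
  have hPn : ∀ x, blk x = n → (fun x => blk x ≠ a) x := fun x hx h => han (h.symm.trans hx)
  have hfar' : ∀ x y, blk x = n → ¬ (fun x => blk x ≠ a) y → Δ x y = 0 := fun x y hx hy => hfar x y hx (not_ne_iff.1 hy)
  have hM0 : 0 ≤ W * R * ((W * (c₁ * δ ^ (X''.card - 2) * R)) ^ 2 * m⁻¹) :=
    mul_nonneg (mul_nonneg (Nat.cast_nonneg _) hR0) (mul_nonneg (sq_nonneg _) (inv_nonneg.2 hm.le))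
  -- the size-free clauses give the `N`-cube regime inequality
  have hreg : 2 ^ (X''.card - 1) * (W * R * ((W * (c₁ * δ ^ (X''.card - 2) * R)) ^ 2 * m⁻¹)) ≤ θ ^ (β' * ((X''.card : ℝ) - 2)) := by
    obtain ⟨k, hk⟩ : ∃ k, X''.card = k + 3 := ⟨X''.card - 3, by omega⟩
    rw [hk, show k + 3 - 1 = k + 2 by omega, show k + 3 - 2 = k + 1 by omega, Nat.cast_add, Nat.cast_ofNat,
      show β' * ((k : ℝ) + 3 - 2) = β' * ((k : ℝ) + 1) by ring]
    exact regime_chainN (Nat.cast_nonneg W) hR0 hm hθ0 hδθ hstep k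
  have hexpG : Real.exp (G * K₁) ≤ Real.exp (2 * G * K₁) :=
    Real.exp_le_exp.2 (by nlinarith [mul_nonneg (Nat.cast_nonneg G) hK₁0])
  rcases H.eq_empty_or_nonempty with rfl | hHne
  · -- the vacuum chain: `c₀ = 1`, `K₀ = θ^{2β′}/2`
    have hK0 : ∀ ψ : α → ℝ, |(∏ i ∈ X'',
        fD (uD χ p ek (slotB B Ys cube X) (fun b : ↥B => Φ b) (fun b : ↥B => c b) (slotY B Ys cube X) (fun Y : ↥Ys => V Y) t)
          (cubeIn cube X) γ ∅ i ψ) - 1| ≤ θ ^ (2 * β') / 2 := fun ψ => by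
      rw [hprod]
      refine (abs_fD_empty_sub_one_le χ p ek B Φ c Ys V cube X t γ haV hK hK₁0 hK₁ hG ht0 ht1 ψ).trans ?_
      linarith
    have hb := abs_actIn_le_of_condMean_fluct blk Δ 0 adj χ p ek B Φ c Ys V cube Λc X t γ ∅ h2 hΔc hm hmΔc hCu hf hfm 1 hK0
      (fun x => blk x ≠ a) hlocP hnX hPn hfar'
      (fun s hs hs0 => fluct_le_chainN blk hΔ hm hΔm hab han X'' hfar hnbr hW hR0 hR ds hc₁ hδ0 hδ1 (X''.card - 2) hgeo Λc hs hs0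
        (hdec s hs hs0))
    refine hb.trans ?_
    rw [card_empty, image_empty, sdiff_empty]
    push_cast
    exact bookkeeping_empty_poly hθ0 hreg
  · -- the decorated chains: `c₀ = 0`, `K₀ = (θ^{1+β′}/2)^{|H|}`
    have hk : 1 ≤ H.card := by have := card_pos.2 hHne; omega
    have hκ : ∀ Y ∈ Ys, KY Y ≤ θ ^ (1 + β') / 2 / Real.exp (2 * G * K₁) := fun Y hY =>
      (le_div_iff₀ (Real.exp_pos _)).2 (hKθ₂ Y hY)
    have hθp : 0 ≤ θ ^ (1 + β') / 2 := div_nonneg (Real.rpow_nonneg hθ0.le _) (by norm_num)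
    have hκ0 : 0 ≤ θ ^ (1 + β') / 2 / Real.exp (2 * G * K₁) := div_nonneg hθp (Real.exp_pos _).le
    have hE1 : 1 ≤ Real.exp (2 * G * K₁) :=
      Real.one_le_exp (mul_nonneg (mul_nonneg (by norm_num) (Nat.cast_nonneg _)) hK₁0)
    have hK0 : ∀ ψ : α → ℝ, |(∏ i ∈ X'',
        fD (uD χ p ek (slotB B Ys cube X) (fun b : ↥B => Φ b) (fun b : ↥B => c b) (slotY B Ys cube X) (fun Y : ↥Ys => V Y) t)
          (cubeIn cube X) γ H i ψ) - 0| ≤ (θ ^ (1 + β') / 2) ^ H.card := fun ψ => by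
      rw [sub_zero, hprod]
      refine (abs_fD_le_of_inr χ p ek B Φ c Ys V cube X t γ haV hK hK₁0 hK₁ hG ht0 ht1 hκ0 hκ H hHa ψ).trans ?_
      rw [div_pow, div_mul_eq_mul_div, div_le_iff₀ (pow_pos (Real.exp_pos _) _)]
      exact mul_le_mul_of_nonneg_left (hexpG.trans (le_self_pow₀ hE1 (by omega))) (pow_nonneg hθp _)
    have hb := abs_actIn_le_of_condMean_fluct blk Δ 0 adj χ p ek B Φ c Ys V cube Λc X t γ H h2 hΔc hm hmΔc hCu hf hfm 0 hK0
      (fun x => blk x ≠ a) hlocP hnX hPn hfar'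
      (fun s hs hs0 => fluct_le_chainN blk hΔ hm hΔm hab han X'' hfar hnbr hW hR0 hR ds hc₁ hδ0 hδ1 (X''.card - 2) hgeo Λc hs hs0
        (hdec s hs hs0))
    refine hb.trans ?_
    -- `a ∈ □(γ(H))`, so at most `|X″| − 1` undecorated cubes
    have hcard : ((X'' \ H.image (cubeIn cube X ∘ γ)).card : ℝ) ≤ (X''.card : ℝ) - 1 := by
      obtain ⟨j, hj⟩ := hHne
      have ha : a ∈ H.image (cubeIn cube X ∘ γ) := mem_image.2 ⟨j, hj, hHa j hj⟩
      have hsub : X'' \ H.image (cubeIn cube X ∘ γ) ⊆ X''.erase a := by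
        intro i hi
        rw [Finset.mem_sdiff] at hi
        exact mem_erase.2 ⟨fun h => hi.2 (h ▸ ha), hi.1⟩
      have hc : (X'' \ H.image (cubeIn cube X ∘ γ)).card + 1 ≤ X''.card := by
        calc (X'' \ H.image (cubeIn cube X ∘ γ)).card + 1 ≤ (X''.erase a).card + 1 := Nat.add_le_add_right (card_le_card hsub) 1
          _ = X''.card := card_erase_add_one haX
      have hc' : ((X'' \ H.image (cubeIn cube X ∘ γ)).card : ℝ) + 1 ≤ (X''.card : ℝ) := by exact_mod_cast hc
      linarith
    calc _ ≤ θ ^ ((H.card : ℝ) + β' * ((X''.card : ℝ) - 1)) := bookkeeping_nonempty_poly hθ0 hθ1 hβ hk hM0 hreg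
      _ ≤ _ := Real.rpow_le_rpow_of_exponent_ge hθ0 hθ1 (by nlinarith [hcard, hβ])

/-- **(5.14.4) LOCATED ON AN END-DECORATED CHAIN OF ANY LENGTH, THE DECAY DERIVED FROM `Δ`-LETTERS** — `ineq5144_locAct_endChainN_of_decay` with
its decay letter (b), its constants `c₁, δ`, its site separation `ds` and its depth clause REPLACED by: a site pseudo-distance `d` (lattice
units), `Δ` of range `1` in `d` with couplings `|Δ_{xy}| ≤ h` and `≤ z` neighbours per site, a Combes–Thomas rate `μ ≥ 0` with `h z(e^μ − 1) ≤ m/2`,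
a unit `ℓ > 0` (print's cube side `r(e_k)` less the coupling range) with the FACE CLAUSE `(|X″| − 2)·ℓ ≤ d(x,l)` for `x ∈ □_n` or `x` a site of `X″`
coupled to `□_n` and `l ∈ □_b` coupled to `□_a`, and the two size-free regime clauses with `c₁ = 2/m`, `δ = e^{−μℓ}`; all other binders verbatim.
[cite: BalabanImbrieJaffe1988, (5.14.4) p.309–310; §5.13 p.305, p.307] [cite: CombesThomas1973, §II] -/
theorem ineq5144_locAct_endChainN_of_combesThomas [Fintype ι] [Fintype υ]
    (hΔ : Δ.PosDef) {m : ℝ} (hm : 0 < m) (hΔm : ∀ φ : α → ℝ, m * (φ ⬝ᵥ φ) ≤ φ ⬝ᵥ (Δ *ᵥ φ))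
    (hΦloc : ∀ b : B, ∀ φ ψ : α → ℝ, (∀ x, blk x = cube (Sum.inl b) → φ x = ψ x) → Φ b φ = Φ b ψ)
    (hVloc : ∀ Y : Ys, ∀ φ ψ : α → ℝ, (∀ x, blk x = cube (Sum.inr Y) → φ x = ψ x) → V Y φ = V Y ψ)
    (hV : ∀ Y ∈ Ys, Measurable (V Y)) {KY : υ → ℝ} (hK : ∀ Y ∈ Ys, ∀ φ, |V Y φ| ≤ KY Y)
    {K₁ : ℝ} (hK₁0 : 0 ≤ K₁) (hK₁ : ∀ Y ∈ Ys, KY Y ≤ K₁) {G : ℕ} (hG : ∀ i, (univ.filter fun τ : ↥B ⊕ ↥Ys => cube τ = i).card ≤ G)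
    {θ β' : ℝ} (hθ0 : 0 < θ) (hθ1 : θ ≤ 1) (hβ : 0 ≤ β')
    (hvac : Real.exp (2 * G * K₁) - 1 ≤ θ ^ (2 * β') / 2) (hKθ₂ : ∀ Y ∈ Ys, KY Y * Real.exp (2 * G * K₁) ≤ θ ^ (1 + β') / 2)
    {W : ℕ} (hW : ∀ i, (univ.filter fun x : α => blk x = i).card ≤ W)
    {R : ℝ} (hR0 : 0 ≤ R) (hR : ∀ x, ∑ y ∈ univ.filter (fun y => blk y ≠ blk x), |Δ x y| ≤ R)
    (hℱ : ℱ = 0) (X'' : Finset I) {a b n : I} (haX : a ∈ X'') (hbX : b ∈ X'') (hnX : n ∈ X'') (hab : a ≠ b) (han : a ≠ n) (hbn : b ≠ n)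
    (haV : ∀ b' : ↥B, cube (Sum.inl b') ≠ a) (hfree : ∀ τ : ↥B ⊕ ↥Ys, cube τ ∈ X'' → cube τ = a)
    (hnbr : ∀ l k, blk l ∈ X'' → blk l ≠ a → blk k = a → Δ l k ≠ 0 → blk l = b)
    -- the `Δ`-letters replacing the decay letter: range, coupling size, neighbour count, Combes–Thomas rate, unit, face clause
    (d : α → α → ℝ) (hd0 : ∀ i, d i i = 0) (hdsymm : ∀ i k, d i k = d k i) (hdtri : ∀ i j k, d i k ≤ d i j + d j k)
    (hband : ∀ x y, 1 < d x y → Δ x y = 0) {h : ℝ} (hh0 : 0 ≤ h) (hh : ∀ x y, x ≠ y → |Δ x y| ≤ h)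
    {z : ℝ} (hz : ∀ x, ((univ.filter fun y => y ≠ x ∧ d x y ≤ 1).card : ℝ) ≤ z)
    {μ : ℝ} (hμ : 0 ≤ μ) (hsmall : h * z * (Real.exp μ - 1) ≤ m / 2) {ℓ : ℝ} (hℓ : 0 < ℓ)
    (hface : ∀ x l, (blk x = n ∨ (blk x ∈ X'' ∧ ∃ y, blk y = n ∧ Δ y x ≠ 0)) → blk l = b → (∃ k, blk k = a ∧ Δ l k ≠ 0) →
      ((X''.card : ℝ) - 2) * ℓ ≤ d x l)
    (Λc X : Finset I)
    (hδθ : 4 * ((W : ℝ) ^ 3 * R ^ 3 * (2 / m) ^ 2 * Real.exp (-(μ * ℓ)) ^ 2) ≤ m * θ ^ β') (hstep : 2 * Real.exp (-(μ * ℓ)) ^ 2 ≤ θ ^ β')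
    {t : ℝ} (ht0 : 0 ≤ t) (ht1 : t ≤ 1) {L : Type} [DecidableEq L] (γ : L → ↥(slotB B Ys cube X) ⊕ ↥(slotY B Ys cube X)) (H : Finset L) :
    |locAct (cubeIn cube X ∘ γ) (actIn blk Δ ℱ adj χ p ek B Φ c Ys V cube Λc X t γ) H X''| ≤
      θ ^ ((H.card : ℝ) + β' * ((X'' \ H.image (cubeIn cube X ∘ γ)).card : ℝ)) := by
  have hdnn : ∀ x y, 0 ≤ d x y := fun x y => by
    have h1 := hdtri x y x
    rw [hd0, hdsymm y x] at h1
    linarith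
  have h2 : 2 ≤ X''.card := Finset.one_lt_card.2 ⟨a, haX, n, hnX, han⟩
  have hcast : (((X''.card - 2 : ℕ) : ℝ)) = (X''.card : ℝ) - 2 := by
    rw [Nat.cast_sub h2, Nat.cast_ofNat]
  exact ineq5144_locAct_endChainN_of_decay blk Δ ℱ adj χ p ek B Φ c Ys V cube hΔ hm hΔm hΦloc hVloc hV hK hK₁0 hK₁ hG hθ0 hθ1 hβ
    hvac hKθ₂ hW hR0 hR hℱ X'' haX hbX hnX hab han hbn haV hfree hnbr (fun x l => ⌊d x l / ℓ⌋₊) (div_nonneg (by norm_num) hm.le)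
    (Real.exp_pos _).le (Real.exp_le_one_iff.2 (neg_nonpos.2 (mul_nonneg hμ hℓ.le)))
    (fun x l hx hl hk => (Nat.le_floor_iff (div_nonneg (hdnn x l) hℓ.le)).2
      (by rw [hcast, le_div_iff₀ hℓ]; exact hface x l hx hl hk))
    Λc X (fun s hs _ x l => restricted_inv_decay_pow blk d hd0 hdsymm hdtri hband hh0 hh hz hΔ hm hΔm hμ hsmall hℓ Λc hs _ x l)
    hδθ hstep ht0 ht1 γ H

end Main

end Literature.MathematicalPhysics.QuantumFieldTheory.BalabanImbrieJaffe1984to88.BIJ88Ineq5144EndChainNDecay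

end
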